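import Summits.ValiantsHypothesis.ValiantsHypothesis.Theorems.KPlusLogSqLawStaticPathReverse

/-!
# Route «KPlusLogSqLaw» — parametric max-weight independent set on a path: the optimal set is read off the RECORDS

HONEST FRAMING.  Helper toward the crux `WeakLifting` (item `stmt-ValiantsHypothesis-19561`, route `KPlusLogSqLaw`, cell `pub-symmetroid`,
seat val-sym-lift-p4 g8, 2026-08-27) on the line of its witness-plan stub `stub_tridiagonalSectorB`: the tropical twin of the STATIC
tridiagonal sector is parametric maximum-weight independent set on a path (val-sym-lift-p4 g5–g7, `HOME/val-sym-lift-p4/LINEAR-LAW.md` §3;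
kernel vocabulary of val-sym-lift-p3 g6: `opt`, `indepSets`, the trains `Δ`, the alternating `fold` of the signed prefix-sum lines).
This file proves the TWO-SIDED RECORD CHARACTERISATION that the located theory (LINEAR-LAW §2–§3: order lemma, event test, fold-corner
identity) rests on: for the block of items `i+1, …, i+n` and a position `x ∈ [0, n]` (between the items `i + x` and `i + x + 1`),

* some optimal independent subset leaves position `x` UNCOVERED (uses neither `i + x` nor `i + x + 1`) iff `x` is a LEFT RECORD — the first `x`
  items do as well without item `i + x`, `opt i x = opt i (x-1)`, i.e. the left train vanishes, `Δ x = 0`, i.e. the alternating fold of the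
  signed prefix-sum lines touches line `x` — AND a RIGHT RECORD — the same for the block read from the right (`exists_opt_avoid_iff`,
  `leftRecord_iff_Δ`, `rightRecord_iff_Δ`, `Δ_eq_zero_iff_fold`);
* hence, when the optimum is unique, its uncovered positions are exactly the common records (`avoid_iff_records_of_unique`,
  `avoid_iff_folds_of_unique`), and since an independent subset is determined by its uncovered positions (`eq_of_avoid_iff`), two parameters
  with the same left records and the same right records have the same unique optimum (`eq_of_records_iff`).

Mechanism: the junction identity `opt_junction` (val-sym-lift-p3 g6) and gluing of block optima across an unused item.  Pure statements about a
path DP; nothing here asserts anything about `WeakLifting`, `TropicalB`, `KPlusLogSqLaw`, the stub in its window, `MatrixDescartes`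
(stmt-ValiantsHypothesis-18050) or `VP ≠ VNP`.
-/

set_option linter.dupNamespace false
set_option autoImplicit false

namespace Summit.ValiantsHypothesis.ValiantsHypothesis.Theorems.KPlusLogSqLaw

open Finset Classical

namespace StaticPathFold

noncomputable section

variable (w₁ w₀ : ℕ → ℝ)

/-! ## 1. Monotonicity of block optima and gluing across an unused item -/

/-- a block does at least as well as the block without its last item. [folklore] -/
theorem opt_pred_le (i k : ℕ) (θ : ℝ) : opt w₁ w₀ i (k - 1) θ ≤ opt w₁ w₀ i k θ := by
  rcases Nat.eq_zero_or_pos k with hk | hk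
  · subst hk; exact le_rfl
  · have h := opt_sub_eq_Δ w₁ w₀ i (k - 1) θ
    have h2 := Δ_nonneg (shift i w₁) (shift i w₀) (k - 1 + 1) θ
    rw [Nat.sub_add_cancel hk] at h h2
    linarith

/-- a block does at least as well as the block without its first item. [folklore] -/
theorem opt_succ_pred_le (j k : ℕ) (θ : ℝ) : opt w₁ w₀ (j + 1) (k - 1) θ ≤ opt w₁ w₀ j k θ := by
  rcases Nat.eq_zero_or_pos k with hk | hk
  · subst hk
    rw [Nat.zero_sub, opt_zero, opt_zero]
  · have h := opt_sub_first_eq_Δ w₁ w₀ j (k - 1) θ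
    have h2 := Δ_nonneg (shift 0 (rev j (k - 1 + 1) w₁)) (shift 0 (rev j (k - 1 + 1) w₀)) (k - 1 + 1) θ
    rw [Nat.sub_add_cancel hk] at h h2
    linarith

/-- **gluing across an unused item**: for `l ≤ n`, the items before `i + l` and the items after it give
`opt i (l-1) + opt (i+l) (n-l) ≤ opt i n` (for `l = 0` the left block is empty and this is an equality). [folklore] -/
theorem opt_skip_le {i n l : ℕ} (hl : l ≤ n) (θ : ℝ) :
    opt w₁ w₀ i (l - 1) θ + opt w₁ w₀ (i + l) (n - l) θ ≤ opt w₁ w₀ i n θ := by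
  rcases Nat.eq_zero_or_pos l with hl0 | hl0
  · subst hl0
    rw [Nat.zero_sub, opt_zero, zero_add, Nat.add_zero, Nat.sub_zero]
  · obtain ⟨A, hA, hAopt⟩ := exists_opt_eq w₁ w₀ i (l - 1) θ
    obtain ⟨B, hB, hBopt⟩ := exists_opt_eq w₁ w₀ (i + l) (n - l) θ
    have hU : A ∪ B ∈ indepSets i n := union_mem_indepSets hA hB (by omega) (by omega)
    rw [hAopt, hBopt, ← sum_union_of_blocks w₁ w₀ hA hB (by omega) θ]
    exact sum_le_opt w₁ w₀ hU θ

/-! ## 2. Independent subsets avoiding two consecutive items -/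

/-- an independent subset of the block that avoids the items `i + x` and `i + x + 1` splits into its part before `i + x` and its part
after `i + x + 1`. [folklore] -/
theorem eq_union_of_avoid {i n x : ℕ} {M : Finset ℕ} (hM : M ∈ indepSets i n)
    (h1 : i + x ∉ M) (h2 : i + x + 1 ∉ M) :
    M = M ∩ Ioc i (i + (x - 1)) ∪ M ∩ Ioc (i + x + 1) (i + x + 1 + (n - x - 1)) := by
  rcases mem_indepSets.mp hM with ⟨hM1, _⟩
  ext t
  simp only [mem_union, mem_inter, mem_Ioc]
  constructor
  · intro ht
    have h := mem_Ioc.mp (hM1 ht)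
    have hne1 : t ≠ i + x := fun he => h1 (he ▸ ht)
    have hne2 : t ≠ i + x + 1 := fun he => h2 (he ▸ ht)
    by_cases hlt : t < i + x
    · exact Or.inl ⟨ht, h.1, by omega⟩
    · exact Or.inr ⟨ht, by omega, by omega⟩
  · rintro (⟨ht, -⟩ | ⟨ht, -⟩) <;> exact ht

/-- **upper bound**: an independent subset avoiding `i + x` and `i + x + 1` weighs at most `opt i (x-1) + opt (i+x+1) (n-x-1)`. [folklore] -/
theorem sum_le_of_avoid {i n x : ℕ} {M : Finset ℕ} (hM : M ∈ indepSets i n)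
    (h1 : i + x ∉ M) (h2 : i + x + 1 ∉ M) (θ : ℝ) :
    ∑ t ∈ M, W w₁ w₀ t θ ≤ opt w₁ w₀ i (x - 1) θ + opt w₁ w₀ (i + x + 1) (n - x - 1) θ := by
  have hA : M ∩ Ioc i (i + (x - 1)) ∈ indepSets i (x - 1) := inter_mem_indepSets hM
  have hB : M ∩ Ioc (i + x + 1) (i + x + 1 + (n - x - 1)) ∈ indepSets (i + x + 1) (n - x - 1) :=
    inter_mem_indepSets hM
  have hsplit := eq_union_of_avoid hM h1 h2
  have hsum := sum_union_of_blocks w₁ w₀ hA hB (by omega) θ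
  rw [← hsplit] at hsum
  rw [hsum]
  exact add_le_add (sum_le_opt w₁ w₀ hA θ) (sum_le_opt w₁ w₀ hB θ)

/-- **attainment**: for `x ≤ n` some independent subset of the block avoids `i + x` and `i + x + 1` and weighs exactly
`opt i (x-1) + opt (i+x+1) (n-x-1)`. [folklore] -/
theorem exists_avoid_eq {i n x : ℕ} (hx : x ≤ n) (θ : ℝ) :
    ∃ M ∈ indepSets i n, i + x ∉ M ∧ i + x + 1 ∉ M ∧
      ∑ t ∈ M, W w₁ w₀ t θ = opt w₁ w₀ i (x - 1) θ + opt w₁ w₀ (i + x + 1) (n - x - 1) θ := by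
  obtain ⟨A, hA, hAopt⟩ := exists_opt_eq w₁ w₀ i (x - 1) θ
  rcases mem_indepSets.mp hA with ⟨hA1, hA2⟩
  have hxA : i + x ∉ A := fun h => by have := mem_Ioc.mp (hA1 h); omega
  have hxA' : i + x + 1 ∉ A := fun h => by have := mem_Ioc.mp (hA1 h); omega
  rcases eq_or_lt_of_le hx with rfl | hlt
  · -- `x = n`: the right block is empty
    refine ⟨A, mem_indepSets.mpr ⟨fun t ht => ?_, hA2⟩, hxA, hxA', ?_⟩
    · have := mem_Ioc.mp (hA1 ht); rw [mem_Ioc]; omega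
    · rw [hAopt, show x - x - 1 = 0 by omega, opt_zero, add_zero]
  · obtain ⟨B, hB, hBopt⟩ := exists_opt_eq w₁ w₀ (i + x + 1) (n - x - 1) θ
    rcases mem_indepSets.mp hB with ⟨hB1, _⟩
    have hU : A ∪ B ∈ indepSets i n := union_mem_indepSets hA hB (by omega) (by omega)
    refine ⟨A ∪ B, hU, ?_, ?_, ?_⟩
    · intro h
      rcases mem_union.mp h with h | h
      · exact hxA h
      · have := mem_Ioc.mp (hB1 h); omega
    · intro h
      rcases mem_union.mp h with h | h
      · exact hxA' h
      · have := mem_Ioc.mp (hB1 h); omega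
    · rw [sum_union_of_blocks w₁ w₀ hA hB (by omega) θ, hAopt, hBopt]

/-! ## 3. The two-sided record characterisation -/

/-- **TWO-SIDED RECORD CHARACTERISATION (existence form).**  For `x ≤ n`: some OPTIMAL independent subset of the block `i+1, …, i+n` uses
neither item `i + x` nor item `i + x + 1` (position `x` is uncovered) iff `x` is a LEFT RECORD, `opt i x = opt i (x-1)`, and a RIGHT
RECORD, `opt (i+x) (n-x) = opt (i+x+1) (n-x-1)`.  (At `x = 0` the left condition and at `x = n` the right condition hold trivially, as they
should: `ℕ`-subtraction.) [folklore] -/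
theorem exists_opt_avoid_iff {i n x : ℕ} (hx : x ≤ n) (θ : ℝ) :
    (∃ M ∈ indepSets i n, ∑ t ∈ M, W w₁ w₀ t θ = opt w₁ w₀ i n θ ∧ i + x ∉ M ∧ i + x + 1 ∉ M) ↔
      (opt w₁ w₀ i x θ = opt w₁ w₀ i (x - 1) θ ∧
        opt w₁ w₀ (i + x) (n - x) θ = opt w₁ w₀ (i + x + 1) (n - x - 1) θ) := by
  -- the two gluings across the unused item `i + x`, resp. `i + x + 1`
  have hlow2 : opt w₁ w₀ i (x - 1) θ + opt w₁ w₀ (i + x) (n - x) θ ≤ opt w₁ w₀ i n θ := opt_skip_le w₁ w₀ hx θ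
  have hlow1 : opt w₁ w₀ i x θ + opt w₁ w₀ (i + x + 1) (n - x - 1) θ ≤ opt w₁ w₀ i n θ := by
    rcases eq_or_lt_of_le hx with rfl | hlt
    · rw [show x - x - 1 = 0 by omega, opt_zero, add_zero]
    · have h := opt_skip_le w₁ w₀ (i := i) (n := n) (l := x + 1) (by omega) θ
      rwa [Nat.add_sub_cancel, ← Nat.add_assoc, ← Nat.sub_sub] at h
  have hm1 := opt_pred_le w₁ w₀ i x θ
  have hm2 : opt w₁ w₀ (i + x + 1) (n - x - 1) θ ≤ opt w₁ w₀ (i + x) (n - x) θ := opt_succ_pred_le w₁ w₀ (i + x) (n - x) θ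
  constructor
  · rintro ⟨M, hM, hopt, h1, h2⟩
    have hup := sum_le_of_avoid w₁ w₀ hM h1 h2 θ
    rw [hopt] at hup
    constructor <;> linarith
  · rintro ⟨hl, hr⟩
    obtain ⟨M, hM, h1, h2, hsum⟩ := exists_avoid_eq w₁ w₀ hx θ
    refine ⟨M, hM, le_antisymm (sum_le_opt w₁ w₀ hM θ) ?_, h1, h2⟩
    rw [hsum]
    -- `opt i n ≤ opt i (x-1) + opt (i+x+1) (n-x-1)` from the junction identity and the two record equalities
    rcases Nat.eq_zero_or_pos x with hx0 | hx0
    · subst hx0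
      simp only [Nat.add_zero, Nat.sub_zero] at hr ⊢
      rw [Nat.zero_sub, opt_zero, zero_add, ← hr]
    rcases eq_or_lt_of_le hx with rfl | hlt
    · rw [show x - x - 1 = 0 by omega, opt_zero, add_zero, hl]
    · have hj := opt_junction w₁ w₀ i x (n - x) hx0 (by omega) θ
      rw [Nat.add_sub_cancel' hx] at hj
      rw [hj]
      refine max_le ?_ ?_
      · rw [hr]
      · rw [hl]

/-- **TWO-SIDED RECORD CHARACTERISATION (unique optimum).**  If `M` is the unique maximiser of the block at `θ`, then for every position
`x ≤ n`: `M` uses neither `i + x` nor `i + x + 1` iff `x` is a left record and a right record at `θ`. [folklore] -/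
theorem avoid_iff_records_of_unique {i n : ℕ} {θ : ℝ} {M : Finset ℕ} (hM : M ∈ indepSets i n)
    (huniq : ∀ S ∈ indepSets i n, S ≠ M → ∑ t ∈ S, W w₁ w₀ t θ < ∑ t ∈ M, W w₁ w₀ t θ) {x : ℕ} (hx : x ≤ n) :
    (i + x ∉ M ∧ i + x + 1 ∉ M) ↔
      (opt w₁ w₀ i x θ = opt w₁ w₀ i (x - 1) θ ∧
        opt w₁ w₀ (i + x) (n - x) θ = opt w₁ w₀ (i + x + 1) (n - x - 1) θ) := by
  have hMopt : ∑ t ∈ M, W w₁ w₀ t θ = opt w₁ w₀ i n θ := by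
    apply le_antisymm (sum_le_opt w₁ w₀ hM θ)
    obtain ⟨S, hS, hSopt⟩ := exists_opt_eq w₁ w₀ i n θ
    rw [hSopt]
    by_cases h : S = M
    · rw [h]
    · exact (huniq S hS h).le
  rw [← exists_opt_avoid_iff w₁ w₀ hx θ]
  constructor
  · rintro ⟨h1, h2⟩
    exact ⟨M, hM, hMopt, h1, h2⟩
  · rintro ⟨S, hS, hSopt, h1, h2⟩
    have hSM : S = M := by
      by_contra h
      have := huniq S hS h
      linarith
    subst hSM
    exact ⟨h1, h2⟩

/-! ## 4. Records as zeros of the trains and as touch points of the alternating folds -/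

/-- **left record ⟺ the left train vanishes**: `opt i x = opt i (x-1) ↔ Δ (shift i) x = 0`. [folklore] -/
theorem leftRecord_iff_Δ (i x : ℕ) (θ : ℝ) :
    opt w₁ w₀ i x θ = opt w₁ w₀ i (x - 1) θ ↔ Δ (shift i w₁) (shift i w₀) x θ = 0 := by
  rcases Nat.eq_zero_or_pos x with hx | hx
  · subst hx
    exact ⟨fun _ => rfl, fun _ => rfl⟩
  · obtain ⟨k, rfl⟩ : ∃ k, x = k + 1 := ⟨x - 1, by omega⟩
    rw [Nat.add_sub_cancel, ← opt_sub_eq_Δ]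
    constructor <;> intro h <;> linarith

/-- **right record ⟺ the left train of the REVERSED block vanishes**: reading the block `i+1, …, i+n` from the right (`rev i n`), position
`x` of the block is position `n - x` of the reversed block, and `opt (i+x) (n-x) = opt (i+x+1) (n-x-1) ↔ Δ (shift 0 (rev i n)) (n - x) = 0`.
[folklore] -/
theorem rightRecord_iff_Δ {i n x : ℕ} (hx : x ≤ n) (θ : ℝ) :
    opt w₁ w₀ (i + x) (n - x) θ = opt w₁ w₀ (i + x + 1) (n - x - 1) θ ↔
      Δ (shift 0 (rev i n w₁)) (shift 0 (rev i n w₀)) (n - x) θ = 0 := by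
  rcases eq_or_lt_of_le hx with rfl | hlt
  · rw [Nat.sub_self, Nat.zero_sub, opt_zero, opt_zero]
    exact ⟨fun _ => rfl, fun _ => rfl⟩
  · -- both optima are optima of the reversed block read from the left (`opt_reflect`)
    have h1 := opt_reflect w₁ w₀ i n (n - x) (Nat.sub_le n x) θ
    have h2 := opt_reflect w₁ w₀ i n (n - x - 1) (by omega) θ
    rw [show n - (n - x) = x by omega] at h1
    rw [show n - (n - x - 1) = x + 1 by omega, ← Nat.add_assoc] at h2
    obtain ⟨k, hk⟩ : ∃ k, n - x = k + 1 := ⟨n - x - 1, by omega⟩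
    rw [h1, h2, hk, Nat.add_sub_cancel, ← opt_sub_eq_Δ]
    constructor <;> intro h <;> linarith

/-- **a train vanishes iff the alternating fold of the signed prefix-sum lines touches the current line** (`fold_alt_eq`):
`Δ a b k θ = 0 ↔ fold (altA a) (altB b) k θ = L (altA a) (altB b) k θ`. [folklore] -/
theorem Δ_eq_zero_iff_fold (a b : ℕ → ℝ) (k : ℕ) (θ : ℝ) :
    Δ a b k θ = 0 ↔ fold (altA a) (altB b) k θ = L (altA a) (altB b) k θ := by
  rw [fold_alt_eq]
  split_ifs <;> constructor <;> intro h <;> linarith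

/-- **the touch points are the active indices**: `fold a b k θ = L a b k θ ↔ lab a b k θ = k`. [folklore] -/
theorem fold_eq_L_iff_lab (a b : ℕ → ℝ) (k : ℕ) (θ : ℝ) : fold a b k θ = L a b k θ ↔ lab a b k θ = k := by
  constructor
  · intro h
    exact le_antisymm (lab_le a b k θ) (Nat.le_findGreatest le_rfl h)
  · intro h
    have := fold_lab_eq a b k θ
    rwa [h] at this

/-- **UNCOVERED POSITIONS = COMMON RECORDS OF THE TWO ALTERNATING FOLDS** (LINEAR-LAW §2/§3, the form used there): if `M` is the unique
maximiser of the block `i+1, …, i+n` at `θ`, then position `x ≤ n` is uncovered by `M` iff the alternating fold of the signed prefix-sum lines of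
the block touches line `x` at `θ` AND the alternating fold of the signed prefix-sum lines of the REVERSED block touches its line `n - x` at `θ`.
[folklore] -/
theorem avoid_iff_folds_of_unique {i n : ℕ} {θ : ℝ} {M : Finset ℕ} (hM : M ∈ indepSets i n)
    (huniq : ∀ S ∈ indepSets i n, S ≠ M → ∑ t ∈ S, W w₁ w₀ t θ < ∑ t ∈ M, W w₁ w₀ t θ) {x : ℕ} (hx : x ≤ n) :
    (i + x ∉ M ∧ i + x + 1 ∉ M) ↔
      (fold (altA (shift i w₁)) (altB (shift i w₀)) x θ = L (altA (shift i w₁)) (altB (shift i w₀)) x θ ∧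
        fold (altA (shift 0 (rev i n w₁))) (altB (shift 0 (rev i n w₀))) (n - x) θ =
          L (altA (shift 0 (rev i n w₁))) (altB (shift 0 (rev i n w₀))) (n - x) θ) := by
  rw [avoid_iff_records_of_unique w₁ w₀ hM huniq hx, leftRecord_iff_Δ, rightRecord_iff_Δ w₁ w₀ hx, Δ_eq_zero_iff_fold,
    Δ_eq_zero_iff_fold]

/-! ## 5. An independent subset is determined by its uncovered positions -/

/-- **injectivity of the uncovered-position map**: two independent subsets of the block `i+1, …, i+n` that leave the same positions
uncovered are equal. [folklore] -/
theorem eq_of_avoid_iff {i n : ℕ} {M M' : Finset ℕ} (hM : M ∈ indepSets i n) (hM' : M' ∈ indepSets i n)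
    (h : ∀ x, x ≤ n → ((i + x ∉ M ∧ i + x + 1 ∉ M) ↔ (i + x ∉ M' ∧ i + x + 1 ∉ M'))) : M = M' := by
  rcases mem_indepSets.mp hM with ⟨hM1, hM2⟩
  rcases mem_indepSets.mp hM' with ⟨hM1', hM2'⟩
  -- membership of `i + x` agrees, by induction on `x`
  have key : ∀ x, x ≤ n + 1 → (i + x ∈ M ↔ i + x ∈ M') := by
    intro x
    induction x with
    | zero =>
      intro _
      constructor
      · intro hi; have := mem_Ioc.mp (hM1 hi); omega
      · intro hi; have := mem_Ioc.mp (hM1' hi); omega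
    | succ x ih =>
      intro hx
      have ihx := ih (by omega)
      show i + x + 1 ∈ M ↔ i + x + 1 ∈ M'
      by_cases hin : i + x ∈ M
      · have hin' := ihx.mp hin
        exact ⟨fun hc => absurd hc (hM2 _ hin), fun hc => absurd hc (hM2' _ hin')⟩
      · have hin' : i + x ∉ M' := fun h' => hin (ihx.mpr h')
        have hx' := h x (by omega)
        constructor
        · intro hmem
          by_contra hne
          exact (hx'.mpr ⟨hin', hne⟩).2 hmem
        · intro hmem
          by_contra hne
          exact (hx'.mp ⟨hin, hne⟩).2 hmem
  ext t
  by_cases ht : i < t ∧ t ≤ i + n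
  · obtain ⟨x, rfl⟩ : ∃ x, t = i + x := ⟨t - i, by omega⟩
    exact key x (by omega)
  · constructor
    · intro hmem; exact absurd (mem_Ioc.mp (hM1 hmem)) ht
    · intro hmem; exact absurd (mem_Ioc.mp (hM1' hmem)) ht

/-- **THE OPTIMUM IS READ OFF THE RECORDS**: if `M` is the unique maximiser of the block at `θ` and `M'` the unique maximiser at `θ'`, and the
two parameters have the same left records and the same right records, then `M = M'`. [folklore] -/
theorem eq_of_records_iff {i n : ℕ} {θ θ' : ℝ} {M M' : Finset ℕ} (hM : M ∈ indepSets i n) (hM' : M' ∈ indepSets i n)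
    (huniq : ∀ S ∈ indepSets i n, S ≠ M → ∑ t ∈ S, W w₁ w₀ t θ < ∑ t ∈ M, W w₁ w₀ t θ)
    (huniq' : ∀ S ∈ indepSets i n, S ≠ M' → ∑ t ∈ S, W w₁ w₀ t θ' < ∑ t ∈ M', W w₁ w₀ t θ')
    (hleft : ∀ x, x ≤ n → (opt w₁ w₀ i x θ = opt w₁ w₀ i (x - 1) θ ↔ opt w₁ w₀ i x θ' = opt w₁ w₀ i (x - 1) θ'))
    (hright : ∀ x, x ≤ n → (opt w₁ w₀ (i + x) (n - x) θ = opt w₁ w₀ (i + x + 1) (n - x - 1) θ ↔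
      opt w₁ w₀ (i + x) (n - x) θ' = opt w₁ w₀ (i + x + 1) (n - x - 1) θ')) : M = M' := by
  refine eq_of_avoid_iff hM hM' fun x hx => ?_
  rw [avoid_iff_records_of_unique w₁ w₀ hM huniq hx, avoid_iff_records_of_unique w₁ w₀ hM' huniq' hx, hleft x hx, hright x hx]

end

end StaticPathFold

end Summit.ValiantsHypothesis.ValiantsHypothesis.Theorems.KPlusLogSqLaw
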